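import Literature.AlgebraicGeometry.Resolution.Henselization
import Literature.AlgebraicGeometry.Resolution.GeneralizedStability
import Mathlib.RingTheory.Henselian
import Mathlib.RingTheory.Polynomial.GaussLemma
import Mathlib.Algebra.Polynomial.Lifts
import Mathlib.Algebra.Polynomial.Eval.Irreducible
import Mathlib.RingTheory.Valuation.Integral
import Mathlib.RingTheory.AlgebraicIndependent.TranscendenceBasis
import Mathlib.FieldTheory.IntermediateField.Adjoin.Algebra
import HarnessLib

/-!
# Hensel's Lemma for henselian valued fields and the lifting of residue field extensions (Kuhlmann 2010, §1.1, §2.5, §5)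

Topic: `Literature/AlgebraicGeometry/Resolution` (valued function fields). F.-V. Kuhlmann,
*Elimination of ramification I*, Trans. AMS 362 (2010) = arXiv:1003.5678, §1.1: "If `K^h = K`,
then `(K,v)` is called henselian. This holds if and only if the extension of `v` from `K` to
every algebraic extension field is unique …, or equivalently, if and only if `(K,v)` satisfies
Hensel's Lemma." The tree renders "henselian" by the uniqueness characterization
(`IsHenselianField`, `Henselization.lean`); the equivalence with Hensel's Lemma (Mathlib's
`HenselianLocalRing` for the valuation ring) is classical ([En], [R]) and is vendored here as the
NAMED FACT `Kuhlmann2010HenselsLemma` (the direction used by the source). With it, the lifting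
step of the proofs of §2.5 (p. 9: "Take a monic polynomial `f` with coefficients in the valuation
ring of `K(x)` and such that `f̄` is the minimal polynomial of `ζ` over `K(x)‾`. By Hensel's
Lemma, `f` has a root `y ∈ F` such that `ȳ = ζ`. Since `deg(f) = deg(f̄)` …") and of Lemma 5.5
(p. 19: "Using Hensel's Lemma, we lift `η` to an element `y' ∈ F` such that …") is PROVED in
the ambient rendering (`(Ω, V)`, subfields `H' ≤ E` of `Ω`):

* `exists_root_lift_of_henselianLocalRing` — if the valuation ring `V ∩ E` of `E` satisfies
  Hensel's Lemma, `H' ≤ E`, and `gbar` is a monic irreducible polynomial over the residue field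
  `H'v ⊆ Ωv` with a simple root `abar ∈ Ev`, then `gbar` lifts to a monic irreducible `g` over `H'`
  of the same degree (Gauss's lemma over the integrally closed `V ∩ H'`) with a root `y ∈ V ∩ E`
  of residue `abar`. PROVED.
* `isAlgebraic_adjoin_singleton_of_transcendental` — transcendence degree one, exchange: if `L`
  is algebraic over `B(t)` for a transcendental `t ∈ L`, then `L` is algebraic over `B(t')` for
  every transcendental `t' ∈ L` (used on p. 19: `F` is algebraic over `K(x')^h(y')`). PROVED
  (Mathlib's transcendence degree `Algebra.trdeg`).

## Sources

* F.-V. Kuhlmann, Trans. AMS 362 (2010) = arXiv:1003.5678: §1.1 (henselian ⇔ Hensel's Lemma),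
  §2.5 (p. 9), Lemma 5.5 (p. 19). [En] = O. Endler, *Valuation theory* (1972); [R] =
  P. Ribenboim, *Théorie des valuations* (1968).
-/

noncomputable section

open IsLocalRing Polynomial

namespace Literature.AlgebraicGeometry.Resolution

universe u

/-! ### Hensel's Lemma (named fact) -/

/-- NAMED FACT — **a henselian valued field satisfies Hensel's Lemma** (Kuhlmann 2010, §1.1:
"`(K,v)` is called henselian. This holds if and only if the extension of `v` from `K` to every
algebraic extension field is unique …, or equivalently, if and only if `(K,v)` satisfies Hensel's
Lemma"; classical, [En], [R]). Rendering: if `(K, O)` is henselian in the sense of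
`IsHenselianField` (unique extension of `O` to every algebraic extension), then the valuation
ring `O` is a henselian local ring in Mathlib's sense (`HenselianLocalRing`: a monic `f ∈ O[X]`
with a simple root modulo the maximal ideal has a root in `O` lifting it). Only this direction of
the printed equivalence is vendored. Not in Mathlib. Users take `(h : Kuhlmann2010HenselsLemma)`.
[cite: Kuhlmann2010, Section 1.1] -/
def Kuhlmann2010HenselsLemma : Prop :=
  ∀ (K : Type u) [Field K] (O : ValuationSubring K), IsHenselianField K O → HenselianLocalRing O

/-! ### Lifting a simple root of a residue polynomial -/

section Lift

variable {Ω : Type u} [Field Ω] (V : ValuationSubring Ω)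

/-- The residue map `V ∩ M → Ωv` of a subfield `M ≤ Ω`. [folklore] -/
def residueHom (M : Subfield Ω) : V.comap (algebraMap M Ω) →+* ResidueField V :=
  (residue V).comp (comapSubringHom M V)

/-- `residueHom` on an element. [folklore] -/
theorem residueHom_apply (M : Subfield Ω) (c : V.comap (algebraMap M Ω)) :
    residueHom V M c = residue V ⟨((c : M) : Ω), c.2⟩ := rfl

/-- `residueHom V M` takes values in the residue field `Mv ⊆ Ωv` of `M`. [folklore] -/
theorem residueHom_mem (M : Subfield Ω) (c : V.comap (algebraMap M Ω)) :
    residueHom V M c ∈ residueSubfield M V :=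
  (mem_residueSubfield_iff M V _).mpr ⟨(c : M), c.2, rfl⟩

/-- The kernel of the residue map is the maximal ideal: `residueHom V M c = 0 ↔ c` is a
non-unit of `V ∩ M`. [folklore] -/
theorem residueHom_eq_zero_iff (M : Subfield Ω) (c : V.comap (algebraMap M Ω)) :
    residueHom V M c = 0 ↔ c ∈ maximalIdeal (V.comap (algebraMap M Ω)) := by
  rw [residueHom, RingHom.comp_apply, residue_eq_zero_iff, IsLocalRing.mem_maximalIdeal,
    IsLocalRing.mem_maximalIdeal, mem_nonunits_iff, mem_nonunits_iff,
    isUnit_map_iff (comapSubringHom M V) c]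

/-- `V ∩ M` is integrally closed (it is a valuation ring of `M`). [folklore] -/
theorem isIntegrallyClosed_comap (M : Subfield Ω) : IsIntegrallyClosed (V.comap (algebraMap M Ω)) := by
  have h := Valuation.Integers.isIntegrallyClosed
    (Valuation.valuationSubring.integers (v := (V.comap (algebraMap M Ω)).valuation))
  rwa [ValuationSubring.valuationSubring_valuation] at h

/-- **Lifting a residue field extension by Hensel's Lemma** (Kuhlmann 2010, §2.5, p. 9: "Take a
monic polynomial `f` with coefficients in the valuation ring of `K(x)` and such that `f̄` is the
minimal polynomial of `ζ` … By Hensel's Lemma, `f` has a root `y ∈ F` such that `ȳ = ζ`. Since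
`deg(f) = deg(f̄)` …"; proof of Lemma 5.5, p. 19: "Using Hensel's Lemma, we lift `η` to an
element `y' ∈ F`"). Inside `(Ω, V)`: subfields `H' ≤ E` with `V ∩ E` a henselian local ring, a
monic irreducible `gbar` over the residue field `H'v ⊆ Ωv` and `abar ∈ Ev` with `gbar(abar) = 0 ≠ gbar'(abar)`;
then there are a monic irreducible `g` over `H'` with `deg g = deg gbar` (a lift of `gbar` with
coefficients in `V ∩ H'`, irreducible over `V ∩ H'` since `gbar` is, and over `H'` by Gauss's lemma
for the integrally closed `V ∩ H'`) and a root `y ∈ V ∩ E` of `g` with residue `abar`. PROVED.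
[cite: Kuhlmann2010, Section 2.5 (p. 9) and Lemma 5.5 (proof)] -/
theorem exists_root_lift_of_henselianLocalRing {H' E : Subfield Ω} (hle : H' ≤ E)
    (hE : HenselianLocalRing (V.comap (algebraMap E Ω)))
    (gbar : Polynomial (residueSubfield H' V)) (hmon : gbar.Monic) (hirr : Irreducible gbar)
    {abar : ResidueField V} (habarE : abar ∈ residueSubfield E V) (hroot : aeval abar gbar = 0)
    (hsimple : aeval abar (derivative gbar) ≠ 0) :
    ∃ (g : Polynomial H') (y : Ω) (hyV : y ∈ V), g.Monic ∧ Irreducible g ∧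
      g.natDegree = gbar.natDegree ∧ y ∈ E ∧ aeval y g = 0 ∧ residue V ⟨y, hyV⟩ = abar := by
  classical
  haveI := hE
  set O : ValuationSubring H' := V.comap (algebraMap H' Ω) with hO
  set OE : ValuationSubring E := V.comap (algebraMap E Ω) with hOE
  -- the residue map `O → k = H'v`, onto
  let θk : O →+* residueSubfield H' V :=
    (residueHom V H').codRestrict (residueSubfield H' V) (residueHom_mem V H')
  have hθk : Function.Surjective θk := by
    rintro ⟨r, hr⟩
    obtain ⟨c, hc, hcr⟩ := (mem_residueSubfield_iff H' V r).mp hr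
    exact ⟨⟨c, hc⟩, Subtype.ext hcr⟩
  have hθk_comp : (algebraMap (residueSubfield H' V) (ResidueField V)).comp θk = residueHom V H' :=
    RingHom.ext fun _ => rfl
  -- lift `gbar` to a monic `gO` over `O`
  obtain ⟨gO, hgO, hdeg, hmonO⟩ := lifts_and_natDegree_eq_and_monic
    ((mem_lifts gbar).mpr (map_surjective θk hθk gbar)) hmon
  -- `gO` is irreducible over `O`, hence over `H'` (Gauss)
  have hirrO : Irreducible gO :=
    Monic.irreducible_of_irreducible_map θk gO hmonO (by rw [hgO]; exact hirr)
  haveI : IsIntegrallyClosed O := isIntegrallyClosed_comap V H'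
  set g : Polynomial H' := gO.map (algebraMap O H') with hg
  have hirrg : Irreducible g := (hmonO.irreducible_iff_irreducible_map_fraction_map).mp hirrO
  have hmong : g.Monic := hmonO.map _
  have hdegg : g.natDegree = gbar.natDegree := by rw [hg, hmonO.natDegree_map, hdeg]
  -- the residue polynomial of `gO` is `gbar`
  have hmapθ : gO.map (residueHom V H') =
      gbar.map (algebraMap (residueSubfield H' V) (ResidueField V)) := by
    rw [← hgO, Polynomial.map_map, hθk_comp]
  -- move to `OE = V ∩ E`
  let ι : O →+* OE :=
    { toFun := fun c => ⟨⟨((c : H') : Ω), hle (c : H').2⟩, c.2⟩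
      map_one' := rfl
      map_mul' := fun _ _ => rfl
      map_zero' := rfl
      map_add' := fun _ _ => rfl }
  have hθι : (residueHom V E).comp ι = residueHom V H' := RingHom.ext fun _ => rfl
  obtain ⟨e, he, heα⟩ := (mem_residueSubfield_iff E V abar).mp habarE
  set a₀ : OE := ⟨e, he⟩ with ha₀
  have hθa₀ : residueHom V E a₀ = abar := heα
  have heval : ∀ q : Polynomial O,
      residueHom V E ((q.map ι).eval a₀) = (q.map (residueHom V H')).eval abar := fun q => by
    rw [← Polynomial.eval₂_at_apply, ← Polynomial.eval_map, Polynomial.map_map, hθι, hθa₀]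
  set gE : Polynomial OE := gO.map ι with hgE
  -- `gE(a₀) ≡ gbar(abar) = 0` and `gE'(a₀) ≡ gbar'(abar) ≠ 0` modulo the maximal ideal
  have h1 : gE.eval a₀ ∈ maximalIdeal OE := by
    rw [← residueHom_eq_zero_iff, hgE, heval, hmapθ, Polynomial.eval_map_algebraMap]
    exact hroot
  have h2 : IsUnit (gE.derivative.eval a₀) := by
    by_contra hnu
    have hmem : gE.derivative.eval a₀ ∈ maximalIdeal OE := (IsLocalRing.mem_maximalIdeal _).mpr hnu
    rw [← residueHom_eq_zero_iff, hgE, Polynomial.derivative_map, heval,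
      ← Polynomial.derivative_map, hmapθ, Polynomial.derivative_map,
      Polynomial.eval_map_algebraMap] at hmem
    exact hsimple hmem
  -- Hensel's Lemma in `OE`
  obtain ⟨y₀, hy₀, hy₀a⟩ := HenselianLocalRing.is_henselian gE (hmonO.map ι) a₀ h1 h2
  refine ⟨g, ((y₀ : E) : Ω), y₀.2, hmong, hirrg, hdegg, (y₀ : E).2, ?_, ?_⟩
  · -- `g(y) = 0`
    have h3 : ((algebraMap E Ω).comp (algebraMap OE E)) (gE.eval y₀) = 0 := by
      rw [hy₀.eq_zero, map_zero]
    rw [← Polynomial.eval₂_at_apply, hgE, Polynomial.eval₂_map] at h3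
    rw [Polynomial.aeval_def, hg, Polynomial.eval₂_map]
    exact h3
  · -- residue of `y` is `abar`
    have h4 : residueHom V E (y₀ - a₀) = 0 := (residueHom_eq_zero_iff V E _).mpr hy₀a
    rw [map_sub, sub_eq_zero, hθa₀] at h4
    exact h4

end Lift

/-! ### Transcendence degree one: algebraic over `B(t')` for any transcendental `t'` -/

section Exchange

variable {Ψ : Type u} [Field Ψ]

/-- **Exchange in transcendence degree one**: for subfields `B ≤ L` of `Ψ`, if every element of
`L` is algebraic over `B(t)` for some transcendental `t ∈ L`, then every element of `L` is
algebraic over `B(t')` for every transcendental `t' ∈ L` (`{t}` is a transcendence basis of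
`L|B`, so `L|B` has transcendence degree `1` and the algebraically independent `{t'}` is a
transcendence basis as well). PROVED from Mathlib's `Algebra.trdeg`. [folklore] -/
theorem isAlgebraic_adjoin_singleton_of_transcendental {B L : Subfield Ψ} (hBL : B ≤ L)
    {t t' : Ψ} (htL : t ∈ L) (ht'L : t' ∈ L) (ht' : Transcendental B t')
    (halg : ∀ z ∈ L, IsAlgebraic (IntermediateField.adjoin B ({t} : Set Ψ)) z) :
    ∀ z ∈ L, IsAlgebraic (IntermediateField.adjoin B ({t'} : Set Ψ)) z := by
  classical
  intro z hz
  set M : IntermediateField B Ψ := Subfield.extendScalars hBL with hM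
  set tM : M := ⟨t, htL⟩ with htM
  set t'M : M := ⟨t', ht'L⟩ with ht'M
  -- `B(sM) ⊆ M` versus `B(s) ⊆ Ψ`, for `s = t, t'`
  have hlift : ∀ (s : Ψ) (hs : s ∈ L) (w : Ψ),
      w ∈ IntermediateField.lift (IntermediateField.adjoin B ({(⟨s, hs⟩ : M)} : Set M)) ↔
        w ∈ IntermediateField.adjoin B ({s} : Set Ψ) := fun s hs w => by
    rw [IntermediateField.lift_adjoin, Set.image_singleton]
  let f : IntermediateField.adjoin B ({tM} : Set M) →+* IntermediateField.adjoin B ({t} : Set Ψ) :=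
    { toFun := fun w => ⟨((w : M) : Ψ),
        (hlift t htL _).mp ((IntermediateField.mem_lift (w : M)).mpr w.2)⟩
      map_one' := rfl
      map_mul' := fun _ _ => rfl
      map_zero' := rfl
      map_add' := fun _ _ => rfl }
  have hf : Function.Surjective f := by
    rintro ⟨u, hu⟩
    have hu' := (hlift t htL u).mpr hu
    exact ⟨⟨⟨u, IntermediateField.lift_le _ hu'⟩,
      (IntermediateField.mem_lift ⟨u, IntermediateField.lift_le _ hu'⟩).mp hu'⟩, rfl⟩
  let f' : IntermediateField.adjoin B ({t'M} : Set M) →+*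
      IntermediateField.adjoin B ({t'} : Set Ψ) :=
    { toFun := fun w => ⟨((w : M) : Ψ),
        (hlift t' ht'L _).mp ((IntermediateField.mem_lift (w : M)).mpr w.2)⟩
      map_one' := rfl
      map_mul' := fun _ _ => rfl
      map_zero' := rfl
      map_add' := fun _ _ => rfl }
  have hf'inj : Function.Injective f' := fun a b h =>
    Subtype.ext (Subtype.ext (congrArg (fun w : IntermediateField.adjoin B ({t'} : Set Ψ) =>
      (w : Ψ)) h))
  -- `M` is algebraic over `B(tM)`
  have halgM : Algebra.IsAlgebraic (IntermediateField.adjoin B ({tM} : Set M)) M := by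
    refine ⟨fun w => ?_⟩
    exact (halg (w : Ψ) w.2).of_ringHom_of_comp_eq f (algebraMap M Ψ) hf
      (algebraMap M Ψ).injective (RingHom.ext fun _ => rfl)
  -- hence `trdeg(M|B) ≤ 1`
  have htr : Algebra.trdeg B M ≤ 1 := by
    haveI : Algebra.IsAlgebraic (Algebra.adjoin B ({tM} : Set M)) M :=
      IntermediateField.isAlgebraic_adjoin_iff_top.mp halgM
    have h := Algebra.IsAlgebraic.trdeg_le_cardinalMk (↥B) ({tM} : Set M)
    rwa [Cardinal.mk_singleton] at h
  -- `{t'M}` is algebraically independent, hence a transcendence basis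
  have ht'Mtr : Transcendental B t'M :=
    (transcendental_algebraMap_iff (algebraMap M Ψ).injective).mp ht'
  have hind : AlgebraicIndependent B ((↑) : ({t'M} : Set M) → M) :=
    (algebraicIndependent_singleton_iff (⟨t'M, Set.mem_singleton t'M⟩ : ({t'M} : Set M))).mpr
      ht'Mtr
  have hbasis : IsTranscendenceBasis B ((↑) : ({t'M} : Set M) → M) :=
    hind.isTranscendenceBasis_of_trdeg_le_of_finite (by rw [Cardinal.mk_singleton]; exact htr)
  have halgM' : Algebra.IsAlgebraic (IntermediateField.adjoin B ({t'M} : Set M)) M := by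
    rw [IntermediateField.isAlgebraic_adjoin_iff_top, ← Subtype.range_coe (s := ({t'M} : Set M))]
    exact hbasis.isAlgebraic
  -- back to `Ψ`
  have h1 : IsAlgebraic (IntermediateField.adjoin B ({t'M} : Set M)) (⟨z, hz⟩ : M) :=
    halgM'.isAlgebraic _
  exact h1.ringHom_of_comp_eq f' (algebraMap M Ψ) hf'inj (RingHom.ext fun _ => rfl)

end Exchange

end Literature.AlgebraicGeometry.Resolution
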